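import Literature.Topology.FourManifolds.PairSaddleRigid
import Literature.Topology.FourManifolds.PairSaddleCover
import HarnessLib

/-!
# The two-field pre-extension map `psi0`: the level conjugation glued with the saddle pieces

Topic `Literature/Topology/FourManifolds` (support file for the two-field handle-extension
endgame of `stmt-SmoothPoincare4-15190`, after `PairSaddleRigid.lean`, `PairSaddleCover.lean`).
Everything here is **proved**; the new definitions are the glued map and its admissibility
predicate.

Griffiths (1964), §§3–6 / Milnor (1965), proof of Thm. 3.13: a boundary map standard near the
meridians is extended along the trajectories and, near the critical points, through the Milnor
coordinates.  For a pair of basin settings `P`, saddle data `Q`, a boundary map `χ` and widths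
`δ, ρ` we define

* `SaddleData.psi0 Q χ δ ρ : W → W` — on `A.dom` the level conjugation `conj χ`
  (`BasinPairConj.lean`); on the exit domains of width `2δ` the exit transports; on the entrance
  domains of width `δ` the entrance transports (`PairSaddleRegions.lean`); on the `ρ`-balls of the
  boxes the model conjugations `MC s`; the identity elsewhere;
* `SaddleData.Adm Q χ δ ρ` — **admissibility**: `0 < δ ≤ ε²`, `0 < ρ ≤ ε`, `ρ⁴ < 8ε²δ` and
  rigidity of `χ` at every saddle with width `2δ` (`PairSaddleRigid.lean`); admissible widths
  exist as soon as `χ` is rigid with some positive width (`Adm.of_rigid`).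

Under admissibility the pieces agree where they overlap (`PairSaddlePassage.lean`,
`PairSaddleRigid.lean`) and cover `{g p₀ < g < hi}` (`PairSaddleCover.lean`), so `psi0` **is each
piece on that piece's open domain** (`psi0_eq_conj`, `psi0_eq_LT_refExit`, `psi0_eq_LT_refEnt`,
`psi0_eq_MC`), hence **smooth and level-preserving on `{g p₀ < g < hi}`** (`contMDiffAt_psi0`,
`apply_psi0`), it **is the transport of `χ` on the level `L`** (`psi0_of_apply_eq_L`), fixes `p₀`,
and **the map of the swapped data and a two-sided inverse `χ'` of `χ` inverts it** (`psi0_swap_psi0`).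

## References

* H. B. Griffiths, *Automorphisms of a 3-dimensional handlebody*, Abh. Math. Sem. Univ. Hamburg
  26 (1964), §§3–6. [GriffithsHB1964Handlebody]
* J. Milnor, *Lectures on the h-cobordism theorem* (1965), Thm. 4.1, proofs of Thms. 3.12–3.13
  (PDF pp. 17–22). [MilnorHCobordism1965]
-/

open scoped Manifold ContDiff Topology
open Set Function Filter Metric

noncomputable section

namespace Literature.Topology.FourManifolds

open Cobordism FourManifolds.Flow

universe u

variable {n : ℕ} {W : Type u} [TopologicalSpace W] [T2Space W] [SecondCountableTopology W]
  [CompactSpace W] [ChartedSpace (EuclideanHalfSpace (n + 1)) W] [IsManifold (𝓡∂ (n + 1)) ∞ W]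
  [Nonempty (BoundaryManifold.boundaryData n W).carrier]

namespace BasinPair

namespace SaddleData

variable {g : W → ℝ} {ξA ξB : Π x : W, TangentSpace (𝓡∂ (n + 1)) x} {P : BasinPair g ξA ξB}
  (Q : P.SaddleData)

/-! ### The glued map and admissible widths -/

open Classical in
/-- **The two-field pre-extension map**: the level conjugation on `A.dom`, the exit transports
(width `2δ`), the entrance transports (width `δ`), the model conjugations on the `ρ`-balls, the
identity elsewhere. [cite: GriffithsHB1964Handlebody, §§3–6] [cite: MilnorHCobordism1965, proof of Thm. 3.13] -/
def psi0 (χ : (𝓡∂ (n + 1)).boundary W → (𝓡∂ (n + 1)).boundary W) (δ ρ : ℝ) (x : W) : W :=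
  if x ∈ P.A.dom then P.conj χ x
  else if h : ∃ s, x ∈ (Q.refExit s (2 * δ)).dom then (Q.refExit h.choose (2 * δ)).LT x
  else if h : ∃ s, x ∈ (Q.refEnt s δ).dom then (Q.refEnt h.choose δ).LT x
  else if h : ∃ s : SaddlePt n g, x ∈ (Q.DA s).chartBall ρ then Q.MC h.choose x
  else x

/-- **Admissible widths** for `psi0`: `0 < δ ≤ ε²`, `0 < ρ ≤ ε`, `ρ⁴ < 8ε²δ`, and rigidity of `χ`
at every saddle with width `2δ`. [cite: GriffithsHB1964Handlebody, §§3–6] -/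
structure Adm (χ : (𝓡∂ (n + 1)).boundary W → (𝓡∂ (n + 1)).boundary W) (δ ρ : ℝ) : Prop where
  /-- the entrance width is positive -/
  δ_pos : 0 < δ
  /-- the entrance width is at most `ε²` -/
  δ_le : δ ≤ Q.ε ^ 2
  /-- the ball radius is positive -/
  ρ_pos : 0 < ρ
  /-- the ball radius is at most `ε` -/
  ρ_le : ρ ≤ Q.ε
  /-- the ball is small compared with the exit width -/
  ρ_pow : ρ ^ 4 < 8 * Q.ε ^ 2 * δ
  /-- `χ` is rigid at every saddle with the exit width `2δ` -/
  rigid : ∀ s, Q.Rigid χ s (2 * δ)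

variable {Q}
variable {χ χ' : (𝓡∂ (n + 1)).boundary W → (𝓡∂ (n + 1)).boundary W} {δ ρ : ℝ}

/-- **Admissible widths exist** when `χ` is rigid at every saddle with one positive width. [folklore] -/
theorem Adm.of_rigid {δR : ℝ} (hδR : 0 < δR) (hR : ∀ s, Q.Rigid χ s δR) :
    ∃ δ ρ, Q.Adm χ δ ρ := by
  have hε := Q.ε_pos
  set δ : ℝ := min (δR / 2) (Q.ε ^ 2) with hδ
  have hδ0 : 0 < δ := lt_min (by linarith) (pow_pos hε 2)
  set ρ : ℝ := min Q.ε (min 1 (Q.ε ^ 2 * δ)) with hρ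
  have hρ0 : 0 < ρ := lt_min hε (lt_min one_pos (by positivity))
  have hρ1 : ρ ≤ 1 := (min_le_right _ _).trans (min_le_left _ _)
  have hρ2 : ρ ≤ Q.ε ^ 2 * δ := (min_le_right _ _).trans (min_le_right _ _)
  refine ⟨δ, ρ, ⟨hδ0, min_le_right _ _, hρ0, min_le_left _ _, ?_, fun s => (hR s).mono ?_⟩⟩
  · have h4 : ρ ^ 4 ≤ ρ := by
      have h2 : ρ ^ 2 ≤ 1 := by nlinarith
      nlinarith [pow_nonneg hρ0.le 2]
    nlinarith [pow_pos hε 2]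
  · have := min_le_left (δR / 2) (Q.ε ^ 2); linarith

/-- Admissibility passes to the swapped data and a left inverse of `χ`. [folklore] -/
theorem Adm.swap (hA : Q.Adm χ δ ρ) (hχ' : LeftInverse χ' χ) : Q.swap.Adm χ' δ ρ :=
  ⟨hA.δ_pos, hA.δ_le, hA.ρ_pos, hA.ρ_le, hA.ρ_pow, fun s' => by
    have h := (hA.rigid (Q.σ.symm s')).swap hχ'
    rwa [Q.σ.apply_symm_apply] at h⟩

/-- `ρ⁴ < 4ε² (2δ)`. [folklore] -/
theorem Adm.ρ_pow' (hA : Q.Adm χ δ ρ) : ρ ^ 4 < 4 * Q.ε ^ 2 * (2 * δ) := by linarith [hA.ρ_pow]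

/-! ### `psi0` is each piece on that piece's domain -/

/-- **On `A.dom`, `psi0` is the level conjugation.** [folklore] -/
theorem psi0_eq_conj {x : W} (hx : x ∈ P.A.dom) : Q.psi0 χ δ ρ x = P.conj χ x := by
  rw [psi0, if_pos hx]

/-- **On the exit domain of `s` (width `2δ`), `psi0` is the exit transport.** [cite: GriffithsHB1964Handlebody, §§3–6] -/
theorem psi0_eq_LT_refExit (hA : Q.Adm χ δ ρ) {s : SaddlePt n g} {x : W} (hx : x ∈ (Q.refExit s (2 * δ)).dom) :
    Q.psi0 χ δ ρ x = (Q.refExit s (2 * δ)).LT x := by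
  by_cases h₁ : x ∈ P.A.dom
  · rw [psi0_eq_conj h₁]; exact conj_eq_LT_refExit (hA.rigid s) h₁ hx
  · have h : ∃ s, x ∈ (Q.refExit s (2 * δ)).dom := ⟨s, hx⟩
    rw [psi0, if_neg h₁, dif_pos h]
    rw [Q.eq_of_mem_dom_refExit_of_mem_dom_refExit h.choose_spec hx]

/-- **On the entrance domain of `s` (width `δ`), `psi0` is the entrance transport.** [cite: GriffithsHB1964Handlebody, §§3–6] -/
theorem psi0_eq_LT_refEnt (hA : Q.Adm χ δ ρ) {s : SaddlePt n g} {x : W} (hx : x ∈ (Q.refEnt s δ).dom) :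
    Q.psi0 χ δ ρ x = (Q.refEnt s δ).LT x := by
  by_cases h₁ : x ∈ P.A.dom
  · rw [psi0_eq_conj h₁]; exact conj_eq_LT_refEnt (hA.rigid s) hA.δ_le le_rfl h₁ hx
  · by_cases h₂ : ∃ s', x ∈ (Q.refExit s' (2 * δ)).dom
    · obtain ⟨s', hs'⟩ := h₂
      have he : s = s' := Q.eq_of_mem_dom_refEnt_of_mem_dom_refExit hA.δ_le hx hs'
      subst he
      rw [Q.psi0_eq_LT_refExit hA hs']
      exact (Q.LT_refEnt_eq_LT_refExit hA.δ_le hx hs').symm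
    · have h : ∃ s, x ∈ (Q.refEnt s δ).dom := ⟨s, hx⟩
      rw [psi0, if_neg h₁, dif_neg h₂, dif_pos h]
      rw [Q.eq_of_mem_dom_refEnt_of_mem_dom_refEnt h.choose_spec hx]

/-- **On the `ρ`-ball of the box of `s`, `psi0` is the model conjugation `MC s`.** [cite: MilnorHCobordism1965, proof of Thm. 3.13] -/
theorem psi0_eq_MC (hA : Q.Adm χ δ ρ) {s : SaddlePt n g} {x : W} (hx : x ∈ (Q.DA s).chartBall ρ) :
    Q.psi0 χ δ ρ x = Q.MC s x := by
  by_cases h₁ : x ∈ P.A.dom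
  · rw [psi0_eq_conj h₁]; exact conj_eq_MC (hA.rigid s) hA.ρ_le hA.ρ_pow' h₁ hx
  · by_cases h₂ : ∃ s', x ∈ (Q.refExit s' (2 * δ)).dom
    · obtain ⟨s', hs'⟩ := h₂
      have he := Q.eq_of_mem_chartBall_of_mem_dom_refExit hA.ρ_le hx hs'
      subst he
      rw [Q.psi0_eq_LT_refExit hA hs']; exact Q.LT_refExit_eq_MC hA.ρ_le hx hs'
    · by_cases h₃ : ∃ s', x ∈ (Q.refEnt s' δ).dom
      · obtain ⟨s', hs'⟩ := h₃
        have he := Q.eq_of_mem_chartBall_of_mem_dom_refEnt hA.ρ_le hx hs'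
        subst he
        rw [Q.psi0_eq_LT_refEnt hA hs']; exact Q.LT_refEnt_eq_MC hA.ρ_le hx hs'
      · have h : ∃ s : SaddlePt n g, x ∈ (Q.DA s).chartBall ρ := ⟨s, hx⟩
        rw [psi0, if_neg h₁, dif_neg h₂, dif_neg h₃, dif_pos h]
        rw [Q.eq_of_mem_chartBall_of_mem_chartBall h.choose_spec hx]

omit [Nonempty (BoundaryManifold.boundaryData n W).carrier] in
/-- A saddle lies in its `ρ`-ball. [folklore] -/
theorem saddle_mem_chartBall (hρ : 0 < ρ) (s : SaddlePt n g) : s.1 ∈ (Q.DA s).chartBall ρ :=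
  (Q.DA s).mem_chartBall_self hρ

/-- **`psi0` sends every saddle to the corresponding saddle.** [folklore] -/
theorem psi0_saddle (hA : Q.Adm χ δ ρ) (s : SaddlePt n g) : Q.psi0 χ δ ρ s.1 = (Q.σ s).1 := by
  rw [Q.psi0_eq_MC hA (Q.saddle_mem_chartBall hA.ρ_pos s), Q.MC_self]

/-- **`psi0` fixes the minimum.** [folklore] -/
theorem psi0_p₀ (hA : Q.Adm χ δ ρ) : Q.psi0 χ δ ρ P.A.p₀ = P.A.p₀ := by
  have hc : IsMCriticalPt (𝓡∂ (n + 1)) g P.A.p₀ := P.A.isMCriticalPt_p₀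
  have h₁ : P.A.p₀ ∉ P.A.dom := fun h => BasinSetting.ne_p₀_of_mem_dom h rfl
  have h₂ : ¬ ∃ s, P.A.p₀ ∈ (Q.refExit s (2 * δ)).dom := fun ⟨s, h⟩ => h.2.1 hc
  have h₃ : ¬ ∃ s, P.A.p₀ ∈ (Q.refEnt s δ).dom := fun ⟨s, h⟩ => h.2.1 hc
  have h₄ : ¬ ∃ s : SaddlePt n g, P.A.p₀ ∈ (Q.DA s).chartBall ρ := fun ⟨s, h⟩ => by
    have h1 := (Q.apply_mem_Ioo_A s h.1 (by linarith [h.2, hA.ρ_le, Q.ε_pos])).1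
    exact lt_irrefl _ (P.A.apply_p₀_lt_sph.trans h1)
  rw [psi0, if_neg h₁, dif_neg h₂, dif_neg h₃, dif_neg h₄]

/-! ### Levels, smoothness -/

/-- **`psi0` preserves `g` on `{g p₀ < g < hi}`.** [cite: GriffithsHB1964Handlebody, §§3–6] -/
theorem apply_psi0 (hA : Q.Adm χ δ ρ) (hχ : ∀ y, χ y ∈ P.B.traces ↔ y ∈ P.A.traces) {x : W}
    (hx : g x ∈ Ioo (g P.A.p₀) P.A.hi) : g (Q.psi0 χ δ ρ x) = g x := by
  rcases Q.cover (δ₂ := 2 * δ) (δ₃ := δ) (by linarith [hA.δ_pos]) hA.δ_pos hx with h | ⟨s, h⟩ | ⟨s, h⟩ | ⟨s, h⟩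
  · rw [psi0_eq_conj h]; exact BasinPair.apply_conj hχ h
  · rw [Q.psi0_eq_LT_refExit hA h]; exact RefData.apply_LT h
  · rw [Q.psi0_eq_LT_refEnt hA h]; exact RefData.apply_LT h
  · rw [h, Q.psi0_saddle hA, Q.apply_eq_c, Q.apply_eq_c]

/-- `psi0` keeps `{g p₀ < g < hi}` (stated for `B`'s levels). [folklore] -/
theorem apply_psi0_mem_Ioo (hA : Q.Adm χ δ ρ) (hχ : ∀ y, χ y ∈ P.B.traces ↔ y ∈ P.A.traces) {x : W}
    (hx : g x ∈ Ioo (g P.A.p₀) P.A.hi) : g (Q.psi0 χ δ ρ x) ∈ Ioo (g P.B.p₀) P.B.hi := by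
  rw [Q.apply_psi0 hA hχ hx, P.apply_p₀_eq, P.hi_eq]; exact hx

/-- **`psi0` is smooth on `{g p₀ < g < hi}`** (each piece is smooth on its open domain; at a
saddle the piece is `MC` on the `ρ`-ball). [cite: GriffithsHB1964Handlebody, §§3–6] [cite: MilnorHCobordism1965, Thm. 4.1, proof of Thm. 5.4 Assertion 4] -/
theorem contMDiffAt_psi0 (hA : Q.Adm χ δ ρ) (hχs : ContMDiff (𝓡 n) (𝓡 n) ∞ χ)
    (hχ : ∀ y, χ y ∈ P.B.traces ↔ y ∈ P.A.traces) {x : W} (hx : g x ∈ Ioo (g P.A.p₀) P.A.hi) :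
    ContMDiffAt (𝓡∂ (n + 1)) (𝓡∂ (n + 1)) ∞ (Q.psi0 χ δ ρ) x := by
  rcases Q.cover (δ₂ := 2 * δ) (δ₃ := δ) (by linarith [hA.δ_pos]) hA.δ_pos hx with h | ⟨s, h⟩ | ⟨s, h⟩ | ⟨s, h⟩
  · have hev : Q.psi0 χ δ ρ =ᶠ[𝓝 x] P.conj χ :=
      Filter.eventuallyEq_of_mem (P.A.isOpen_dom.mem_nhds h) fun y hy => psi0_eq_conj hy
    exact hev.contMDiffAt_iff.2 (BasinPair.contMDiffAt_conj hχs hχ h)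
  · have hev : Q.psi0 χ δ ρ =ᶠ[𝓝 x] (Q.refExit s (2 * δ)).LT :=
      Filter.eventuallyEq_of_mem ((RefData.isOpen_dom _).mem_nhds h) fun y hy => Q.psi0_eq_LT_refExit hA hy
    exact hev.contMDiffAt_iff.2 (RefData.contMDiffAt_LT h)
  · have hev : Q.psi0 χ δ ρ =ᶠ[𝓝 x] (Q.refEnt s δ).LT :=
      Filter.eventuallyEq_of_mem ((RefData.isOpen_dom _).mem_nhds h) fun y hy => Q.psi0_eq_LT_refEnt hA hy
    exact hev.contMDiffAt_iff.2 (RefData.contMDiffAt_LT h)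
  · subst h
    have hev : Q.psi0 χ δ ρ =ᶠ[𝓝 s.1] Q.MC s :=
      Filter.eventuallyEq_of_mem ((Q.DA s).isOpen_chartBall.mem_nhds (Q.saddle_mem_chartBall hA.ρ_pos s))
        fun y hy => Q.psi0_eq_MC hA hy
    exact hev.contMDiffAt_iff.2 (Q.contMDiffAt_MC (Q.DA s).mem_source
      (by rw [(Q.DA s).coord_self, norm_zero]; linarith [Q.ε_pos]))

/-! ### The level `L` -/

/-- **On the level `L`, `psi0` is the transport of `χ`** — on the basin by the level conjugation,
on the traces by rigidity at the point of the unstable sphere below. [cite: GriffithsHB1964Handlebody, §§3–6] -/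
theorem psi0_of_apply_eq_L (hA : Q.Adm χ δ ρ) {w : W} (hw : g w = P.A.L) : Q.psi0 χ δ ρ w = P.transportAB χ w := by
  have hwI : g w ∈ Ioo (g P.A.p₀) P.A.hi := by
    rw [hw]; exact ⟨(P.A.crit_lt _ P.A.isMCriticalPt_p₀).trans P.A.one_sub_a'_lt_L, P.A.L_lt_hi⟩
  have htop : P.A.top w = w := P.A.top_of_apply_eq hw
  have htr : g (P.transportAB χ w) = P.B.L := by rw [P.apply_transportAB, P.L_eq]
  have hreg : ¬ IsMCriticalPt (𝓡∂ (n + 1)) g (P.transportAB χ w) := P.B.not_isMCriticalPt_of_eq_L htr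
  have hslab : P.A.L ∈ Icc P.B.lo P.B.hi := by rw [← P.L_eq]; exact Ioo_subset_Icc_self P.B.L_mem_Ioo
  rcases Q.cover (δ₂ := 2 * δ) (δ₃ := δ) (by linarith [hA.δ_pos]) hA.δ_pos hwI with h | ⟨s, h⟩ | ⟨s, h⟩ | ⟨s, h⟩
  · rw [psi0_eq_conj h, BasinPair.conj_def, htop, hw]
    exact P.B.levelProj_eq_self hreg hslab (by rw [htr, P.L_eq])
  · rw [Q.psi0_eq_LT_refExit hA h, RefData.LT_def, hw]
    set z := (Q.refExit s (2 * δ)).ref w with hz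
    have hzU : z ∈ Q.Uexit s (2 * δ) := RefData.ref_mem_U h
    have hzℓ : g z = Q.c + Q.ε ^ 2 := RefData.apply_ref h
    have htopz : P.A.top z = w := by
      rw [hz, RefData.ref_def, levelProj_apply, P.A.top_θ (hits_of_apply_eq (P.A.θ_zero w) hw), htop]
    have hrig := hA.rigid s z hzU hzℓ
    rw [htopz] at hrig
    rw [hrig, BasinSetting.top_def, P.L_eq]
    rfl
  · exact absurd h.1.2 (not_lt.2 (Q.c_lt_L.le.trans (le_of_eq hw.symm)))
  · exfalso
    have h1 := Q.apply_eq_c s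
    rw [← h, hw] at h1
    exact (ne_of_gt Q.c_lt_L) h1

/-! ### The inverse -/

/-- **The glued map of the swapped data and a two-sided inverse `χ'` of `χ` inverts `psi0`** on
`{g p₀ < g < hi}`. [cite: GriffithsHB1964Handlebody, §§3–6] -/
theorem psi0_swap_psi0 (hA : Q.Adm χ δ ρ) (hχ : ∀ y, χ y ∈ P.B.traces ↔ y ∈ P.A.traces)
    (hχ' : LeftInverse χ' χ) {x : W} (hx : g x ∈ Ioo (g P.A.p₀) P.A.hi) :
    Q.swap.psi0 χ' δ ρ (Q.psi0 χ δ ρ x) = x := by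
  have hA' : Q.swap.Adm χ' δ ρ := hA.swap hχ'
  rcases Q.cover (δ₂ := 2 * δ) (δ₃ := δ) (by linarith [hA.δ_pos]) hA.δ_pos hx with h | ⟨s, h⟩ | ⟨s, h⟩ | ⟨s, h⟩
  · rw [psi0_eq_conj h, psi0_eq_conj (Q := Q.swap) (χ := χ') (δ := δ) (ρ := ρ) (BasinPair.conj_mem_dom hχ h)]
    exact BasinPair.conj_swap_conj hχ' hχ h
  · obtain ⟨hmem, hinv⟩ := Q.LT_refExit_swap_LT h
    rw [Q.psi0_eq_LT_refExit hA h, Q.swap.psi0_eq_LT_refExit hA' hmem, hinv]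
  · obtain ⟨hmem, hinv⟩ := Q.LT_refEnt_swap_LT h
    rw [Q.psi0_eq_LT_refEnt hA h, Q.swap.psi0_eq_LT_refEnt hA' hmem, hinv]
  · rw [h, Q.psi0_saddle hA, Q.swap.psi0_saddle hA', Q.swap_σ, Q.σ.symm_apply_apply]

end SaddleData

end BasinPair

end Literature.Topology.FourManifolds
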